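import Summits.CriticalPhenomena.PercolationContinuityZ3.Theorems.PercNearOneGluingNoHeavyQuantFarTreeLayerOne
import HarnessLib

/-!
# QUANT lane R8 — the chain of a relay in a rooted tree: chain prefixes, levels of the other vertices, inner chains

builds on p205010 (kernel theorem, internal audit signed; external expert review pending)

Support file (`--supports stmt-CriticalPhenomena-4575`), QUANT lane lead (gen 8), rung R8 of
`run/shared/lean/prim/quant/LADDER.md`; memo `prim-quant-lead-g7/LEAD-NOTES-G7.md` N17 Step 0/1 (the chain decomposition), combinatorial
part.  Trees in `par`/`depth` coordinates as in `…QuantTreeClusterTransfer.lean` / `…QuantFarTreeLayerOne.lean` (root `o`; for `x ≠ o` the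
ancestral chain `anc x = {par^[i] x | i ≤ depth x}`, `x` included, `o` excluded; generic vertex type, classical decidability).
Theorems only; no sorries; standard axioms.

Fix a vertex `a ≠ o` of depth `D`.  Its chain, listed from the top, is `v j = par^[D − j] a` (`j = 0, …, D`; `depth (v j) = j`, `v D = a`);
the PREFIXES are `Ch k = {v 0, …, v (k−1)}` (`Ch (D+1) = anc a`).  For another vertex `b ≠ o` with `b ∉ anc a`, `a ∉ anc b`
(neither is an ancestor of the other) the trace `anc a ∩ anc b` is a proper prefix `Ch k`, `k = |anc a ∩ anc b| ≤ D` — the LEVEL of `b` —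
and `anc b = Ch k ⊔ (anc b ∖ anc a)` (chain part, INNER part).  Inner parts of vertices of different levels are disjoint, and disjoint
from `anc a`.  These are the bookkeeping facts behind the level recursion of `…QuantFarTreeMultiCompanion.lean`.
* `Quant.anc_inter_eq_of_mem_sdiff` — for `u ∈ anc b ∖ anc a`: `anc a ∩ anc u = anc a ∩ anc b` (the level is read off any inner vertex);
* `Quant.chainV_mem_anc`, `Quant.depth_chainV`, `Quant.anc_eq_image_chainV`, `Quant.chainV_mem_anc_chainV`, `Quant.chainPrefix_subset_anc`,
  `Quant.chainPrefix_mono`, `Quant.chainPrefix_top`, `Quant.card_chainPrefix`;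
* `Quant.anc_inter_eq_chainPrefix` — `anc a ∩ anc b = Ch |anc a ∩ anc b|` and `|anc a ∩ anc b| ≤ D`;
* `Quant.anc_eq_chainPrefix_union_inner`, `Quant.inner_disjoint_anc_of_level_ne`.
[this work]
-/

namespace Summit.CriticalPhenomena.PercolationContinuityZ3.Theorems

namespace Quant

open Finset
open scoped Classical

variable {ι : Type*}

/-- For an inner vertex `u ∈ anc b ∖ anc a` the traces on `anc a` agree: `anc a ∩ anc u = anc a ∩ anc b`. [this work] -/
theorem anc_inter_eq_of_mem_sdiff (o : ι) (depth : ι → ℕ) (par : ι → ι)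
    (hstep : ∀ x, x ≠ o → depth x ≠ 0 → par x ≠ o ∧ depth (par x) + 1 = depth x)
    {a b u : ι} (hao : a ≠ o) (hbo : b ≠ o)
    (hu : u ∈ (Finset.range (depth b + 1)).image (fun i => par^[i] b))
    (hua : u ∉ (Finset.range (depth a + 1)).image (fun i => par^[i] a)) :
    (Finset.range (depth a + 1)).image (fun i => par^[i] a) ∩ (Finset.range (depth u + 1)).image (fun i => par^[i] u) =
      (Finset.range (depth a + 1)).image (fun i => par^[i] a) ∩ (Finset.range (depth b + 1)).image (fun i => par^[i] b) := by
  ext v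
  simp only [Finset.mem_inter]
  constructor
  · rintro ⟨hva, hvu⟩
    exact ⟨hva, tree_anc_subset o depth par hstep hbo hu hvu⟩
  · rintro ⟨hva, hvb⟩
    refine ⟨hva, ?_⟩
    rcases le_total (depth v) (depth u) with hle | hle
    · exact tree_anc_chain o depth par hstep hbo hvb hu hle
    · exact absurd (tree_anc_subset o depth par hstep hao hva (tree_anc_chain o depth par hstep hbo hu hvb hle)) hua

/-! ### The chain of `a` from the top: `v j = par^[depth a − j] a` and its prefixes -/

/-- Every `par^[depth a − j] a` lies on the chain of `a`. [this work] -/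
theorem chainV_mem_anc (depth : ι → ℕ) (par : ι → ι) (a : ι) (j : ℕ) :
    par^[depth a - j] a ∈ (Finset.range (depth a + 1)).image (fun i => par^[i] a) :=
  (tree_mem_anc depth par a _).2 ⟨depth a - j, Nat.sub_le _ _, rfl⟩

/-- `depth (par^[depth a − j] a) = j` for `j ≤ depth a`. [this work] -/
theorem depth_chainV (o : ι) (depth : ι → ℕ) (par : ι → ι)
    (hstep : ∀ x, x ≠ o → depth x ≠ 0 → par x ≠ o ∧ depth (par x) + 1 = depth x)
    {a : ι} (hao : a ≠ o) {j : ℕ} (hj : j ≤ depth a) : depth (par^[depth a - j] a) = j := by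
  have := (chain_iterate_par o depth par hstep a hao (depth a - j) (Nat.sub_le _ _)).2
  omega

/-- The chain of `a` is `{par^[depth a − j] a | j ≤ depth a}`. [this work] -/
theorem anc_eq_image_chainV (depth : ι → ℕ) (par : ι → ι) (a : ι) :
    (Finset.range (depth a + 1)).image (fun i => par^[i] a) =
      (Finset.range (depth a + 1)).image (fun j => par^[depth a - j] a) := by
  ext u
  simp only [Finset.mem_image, Finset.mem_range]
  constructor
  · rintro ⟨i, hi, rfl⟩
    exact ⟨depth a - i, by omega, by rw [show depth a - (depth a - i) = i by omega]⟩
  · rintro ⟨j, hj, rfl⟩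
    exact ⟨depth a - j, by omega, rfl⟩

/-- Down-closure along the chain: `v j ∈ anc (v j')` for `j ≤ j' ≤ depth a`. [this work] -/
theorem chainV_mem_anc_chainV (o : ι) (depth : ι → ℕ) (par : ι → ι)
    (hstep : ∀ x, x ≠ o → depth x ≠ 0 → par x ≠ o ∧ depth (par x) + 1 = depth x)
    {a : ι} (hao : a ≠ o) {j j' : ℕ} (hjj : j ≤ j') (hj' : j' ≤ depth a) :
    par^[depth a - j] a ∈ (Finset.range (depth (par^[depth a - j'] a) + 1)).image (fun i => par^[i] (par^[depth a - j'] a)) := by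
  refine (tree_mem_anc depth par (par^[depth a - j'] a) (par^[depth a - j] a)).2 ⟨j' - j, ?_, ?_⟩
  · rw [depth_chainV o depth par hstep hao hj']; omega
  · rw [← Function.iterate_add_apply]
    congr 1
    omega

/-- Chain prefixes lie on the chain. [this work] -/
theorem chainPrefix_subset_anc (depth : ι → ℕ) (par : ι → ι) (a : ι) (k : ℕ) :
    (Finset.range k).image (fun j => par^[depth a - j] a) ⊆ (Finset.range (depth a + 1)).image (fun i => par^[i] a) := by
  intro u hu
  obtain ⟨j, -, rfl⟩ := Finset.mem_image.1 hu
  exact chainV_mem_anc depth par a j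

/-- Chain prefixes are nested. [this work] -/
theorem chainPrefix_mono (depth : ι → ℕ) (par : ι → ι) (a : ι) {k k' : ℕ} (h : k ≤ k') :
    (Finset.range k).image (fun j => par^[depth a - j] a) ⊆ (Finset.range k').image (fun j => par^[depth a - j] a) :=
  Finset.image_subset_image (Finset.range_mono h)

/-- The full prefix is the chain. [this work] -/
theorem chainPrefix_top (depth : ι → ℕ) (par : ι → ι) (a : ι) :
    (Finset.range (depth a + 1)).image (fun j => par^[depth a - j] a) = (Finset.range (depth a + 1)).image (fun i => par^[i] a) :=
  (anc_eq_image_chainV depth par a).symm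

/-- The chain vertices `v j`, `j ≤ depth a`, are pairwise distinct (their depths differ), so `|Ch k| = k` for `k ≤ depth a + 1`. [this work] -/
theorem card_chainPrefix (o : ι) (depth : ι → ℕ) (par : ι → ι)
    (hstep : ∀ x, x ≠ o → depth x ≠ 0 → par x ≠ o ∧ depth (par x) + 1 = depth x)
    {a : ι} (hao : a ≠ o) {k : ℕ} (hk : k ≤ depth a + 1) :
    ((Finset.range k).image (fun j => par^[depth a - j] a)).card = k := by
  rw [Finset.card_image_of_injOn, Finset.card_range]
  intro j hj j' hj' h
  have hj1 : j ≤ depth a := by have := Finset.mem_range.1 (Finset.mem_coe.1 hj); omega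
  have hj2 : j' ≤ depth a := by have := Finset.mem_range.1 (Finset.mem_coe.1 hj'); omega
  have e1 := depth_chainV o depth par hstep hao hj1
  have e2 := depth_chainV o depth par hstep hao hj2
  have : depth (par^[depth a - j] a) = depth (par^[depth a - j'] a) := by
    show depth ((fun j => par^[depth a - j] a) j) = depth ((fun j => par^[depth a - j] a) j')
    rw [h]
  omega

/-! ### Levels -/

/-- **The trace of another chain is a chain prefix.**  For `b ≠ o` with `a ∉ anc b` (so `b` is not below `a`):
`anc a ∩ anc b = Ch k` with `k = |anc a ∩ anc b| ≤ depth a` (if moreover `b ∉ anc a` this is the level of `b`). [this work] -/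
theorem anc_inter_eq_chainPrefix (o : ι) (depth : ι → ℕ) (par : ι → ι)
    (hstep : ∀ x, x ≠ o → depth x ≠ 0 → par x ≠ o ∧ depth (par x) + 1 = depth x)
    {a b : ι} (hao : a ≠ o) (hbo : b ≠ o) (hab : a ∉ (Finset.range (depth b + 1)).image (fun i => par^[i] b)) :
    (Finset.range (depth a + 1)).image (fun i => par^[i] a) ∩ (Finset.range (depth b + 1)).image (fun i => par^[i] b) =
        (Finset.range ((Finset.range (depth a + 1)).image (fun i => par^[i] a) ∩
          (Finset.range (depth b + 1)).image (fun i => par^[i] b)).card).image (fun j => par^[depth a - j] a) ∧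
      ((Finset.range (depth a + 1)).image (fun i => par^[i] a) ∩ (Finset.range (depth b + 1)).image (fun i => par^[i] b)).card ≤
        depth a := by
  set D := depth a with hD
  set ancb := (Finset.range (depth b + 1)).image (fun i => par^[i] b) with hancb
  -- `P j` : the `j`-th chain vertex is an ancestor of `b`; down-closed, false at `j = D`
  have hdc : ∀ j j', j ≤ j' → j' ≤ D → par^[D - j'] a ∈ ancb → par^[D - j] a ∈ ancb := by
    intro j j' hjj hj' hP
    exact tree_anc_subset o depth par hstep hbo hP (chainV_mem_anc_chainV o depth par hstep hao hjj hj')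
  have hnotD : par^[D - D] a ∉ ancb := by rw [Nat.sub_self]; exact hab
  have hex : ∃ j, par^[D - j] a ∉ ancb := ⟨D, hnotD⟩
  set k := Nat.find hex with hk
  have hkD : k ≤ D := Nat.find_le hnotD
  have hlt : ∀ j, j < k → par^[D - j] a ∈ ancb := fun j hj => by
    have := Nat.find_min hex hj
    simpa using this
  have hge : ∀ j, k ≤ j → j ≤ D → par^[D - j] a ∉ ancb := fun j hkj hjD hP =>
    (Nat.find_spec hex) (hdc k j hkj hjD hP)
  -- the intersection is `Ch k`
  have heq : (Finset.range (D + 1)).image (fun i => par^[i] a) ∩ ancb = (Finset.range k).image (fun j => par^[D - j] a) := by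
    ext u
    simp only [Finset.mem_inter]
    constructor
    · rintro ⟨hua, hub⟩
      rw [anc_eq_image_chainV depth par a] at hua
      obtain ⟨j, hj, rfl⟩ := Finset.mem_image.1 hua
      have hjD : j ≤ D := by have := Finset.mem_range.1 hj; omega
      have hjk : j < k := by
        by_contra h
        exact hge j (not_lt.1 h) hjD hub
      exact Finset.mem_image.2 ⟨j, Finset.mem_range.2 hjk, rfl⟩
    · intro hu
      obtain ⟨j, hj, rfl⟩ := Finset.mem_image.1 hu
      have hjk := Finset.mem_range.1 hj
      exact ⟨chainV_mem_anc depth par a j, hlt j hjk⟩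
  have hcard : ((Finset.range (D + 1)).image (fun i => par^[i] a) ∩ ancb).card = k := by
    rw [heq, card_chainPrefix o depth par hstep hao (by omega)]
  rw [hcard]
  exact ⟨heq, hkD⟩

/-- The chain of `b` splits into its trace on `anc a` (a chain prefix of `a`) and its INNER part `anc b ∖ anc a`, disjointly. [this work] -/
theorem anc_eq_chainPrefix_union_inner (o : ι) (depth : ι → ℕ) (par : ι → ι)
    (hstep : ∀ x, x ≠ o → depth x ≠ 0 → par x ≠ o ∧ depth (par x) + 1 = depth x)
    {a b : ι} (hao : a ≠ o) (hbo : b ≠ o) (hab : a ∉ (Finset.range (depth b + 1)).image (fun i => par^[i] b)) :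
    (Finset.range (depth b + 1)).image (fun i => par^[i] b) =
        (Finset.range ((Finset.range (depth a + 1)).image (fun i => par^[i] a) ∩
          (Finset.range (depth b + 1)).image (fun i => par^[i] b)).card).image (fun j => par^[depth a - j] a) ∪
        ((Finset.range (depth b + 1)).image (fun i => par^[i] b) \ (Finset.range (depth a + 1)).image (fun i => par^[i] a)) ∧
      Disjoint ((Finset.range ((Finset.range (depth a + 1)).image (fun i => par^[i] a) ∩
          (Finset.range (depth b + 1)).image (fun i => par^[i] b)).card).image (fun j => par^[depth a - j] a))
        ((Finset.range (depth b + 1)).image (fun i => par^[i] b) \ (Finset.range (depth a + 1)).image (fun i => par^[i] a)) := by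
  obtain ⟨heq, -⟩ := anc_inter_eq_chainPrefix o depth par hstep hao hbo hab
  rw [← heq]
  constructor
  · ext u
    simp only [Finset.mem_union, Finset.mem_inter, Finset.mem_sdiff]
    tauto
  · exact Finset.disjoint_of_subset_left Finset.inter_subset_left Finset.disjoint_sdiff

/-- **Inner parts of different levels are disjoint**: for `b, y ≠ o`, neither below `a`... more precisely `a ∉ anc b`, `a ∉ anc y`, with
`|anc a ∩ anc b| ≠ |anc a ∩ anc y|`, the inner part `anc b ∖ anc a` is disjoint from the whole chain `anc y`. [this work] -/
theorem inner_disjoint_anc_of_level_ne (o : ι) (depth : ι → ℕ) (par : ι → ι)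
    (hstep : ∀ x, x ≠ o → depth x ≠ 0 → par x ≠ o ∧ depth (par x) + 1 = depth x)
    {a b y : ι} (hao : a ≠ o) (hbo : b ≠ o) (hyo : y ≠ o)
    (hne : ((Finset.range (depth a + 1)).image (fun i => par^[i] a) ∩ (Finset.range (depth b + 1)).image (fun i => par^[i] b)).card ≠
      ((Finset.range (depth a + 1)).image (fun i => par^[i] a) ∩ (Finset.range (depth y + 1)).image (fun i => par^[i] y)).card) :
    Disjoint ((Finset.range (depth b + 1)).image (fun i => par^[i] b) \ (Finset.range (depth a + 1)).image (fun i => par^[i] a))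
      ((Finset.range (depth y + 1)).image (fun i => par^[i] y)) := by
  rw [Finset.disjoint_left]
  intro u hub huy
  rw [Finset.mem_sdiff] at hub
  apply hne
  rw [← anc_inter_eq_of_mem_sdiff o depth par hstep hao hbo hub.1 hub.2,
    ← anc_inter_eq_of_mem_sdiff o depth par hstep hao hyo huy hub.2]

end Quant

end Summit.CriticalPhenomena.PercolationContinuityZ3.Theorems
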